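import Mathlib.Analysis.Calculus.Deriv.MeanValue
import Mathlib.Analysis.SpecialFunctions.Pow.Deriv
import HarnessLib

/-!
# "The norm must not grow too rapidly": the upper edge of the `L^q` blow-up window

Analysis/FluidPDE file, real-variable core of the UPPER edge of the window of growth exponents
compatible with a finite-time singularity (Protas 2026 essay, §4.1, between eqs. (49) and (50);
BOUNDS.md (2.5) of the fluid-computer cell). The Ladyzhenskaya–Prodi–Serrin / ESS criterion
(essay (41)–(43)) says a smooth solution loses regularity at `T*` only if
`∫₀^{T*} ‖u(t)‖_{L^q}^p dt = ∞`, `2/p + 3/q = 1`, `3 < q ≤ ∞`; the essay observes that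
"`‖u(t)‖_{L^q}` cannot diverge too rapidly as `t₀` is approached since in that case the integral
in (43) would remain finite (… it would exist as an improper integral)" and "for a blow-up to
occur in a Navier–Stokes flow, the norm `‖u(t)‖_{L^q}` must not grow too rapidly".

The theorem below is the calculus fact behind that sentence, with every hypothesis explicit and
no measure theory: if `y > 0` on `[a, b]` grows at least like `y' ≥ c y^α` with `α > p + 1`, then
ANY primitive `P` of `y^p` on `[a, b]` satisfies
`P(b) − P(a) ≤ (y(a)^{p+1−α} − y(b)^{p+1−α}) / (c (α − p − 1)) ≤ y(a)^{p+1−α} / (c (α − p − 1))`,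
a bound UNIFORM in `b`; so a rate exponent `α > 1 + p` sustained up to `T*` keeps
`∫ₐ^{T*} y^p` finite and is incompatible with the LPS divergence. With `p = 2q/(q − 3)` the edge
`α = 1 + p = 3(q − 1)/(q − 3)` is the exponent of the instantaneous estimate (essay (48),
`d/dt ‖u‖_{L^q} ≤ C ‖u‖_{L^q}^{1 + 2q/(q−3)}`), i.e. the rigorous upper bound sits exactly at
the upper edge of the window (`q = 4, 5, 6, 9 ↦ α = 9, 6, 5, 4`). The proof: the function
`P + y^{p+1−α}/(c (α − p − 1))` is nonincreasing on `[a, b]`.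

Deliberately NOT here: the LPS criterion itself (named elsewhere in the tree), the lower edge
(essay (50), from the a-priori bounds (44) and Grönwall), and any statement about solutions.
-/

noncomputable section

open Set

namespace Literature.Analysis.FluidPDE

section BlowupWindow

/-- **Fast growth makes the LPS integral converge.** Let `a < b`, `0 < c`, `p + 1 < α`, `f > 0`
on `[a, b]` with one-sided derivatives `f'` within `[a, b]` satisfying `c f^α ≤ f'`, and let `P`
be any primitive of `f^p` on `[a, b]` (one-sided derivatives within `[a, b]`). Then
`P(b) − P(a) ≤ (f(a)^{p+1−α} − f(b)^{p+1−α}) / (c (α − p − 1))`. Real (`rpow`) exponents; the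
dictionary `f = ‖u(·)‖_{L^q}`, `p = 2q/(q−3)` is in the module docstring.
[cite: Protas2026, §4.1, between eqs. (49) and (50)] -/
theorem primitive_sub_le_of_mul_rpow_le_deriv {f f' P : ℝ → ℝ} {a b c α p : ℝ} (hab : a < b)
    (hc : 0 < c) (hαp : p + 1 < α)
    (hf : ∀ t ∈ Icc a b, HasDerivWithinAt f (f' t) (Icc a b) t)
    (hP : ∀ t ∈ Icc a b, HasDerivWithinAt P (f t ^ p) (Icc a b) t)
    (hpos : ∀ t ∈ Icc a b, 0 < f t) (hge : ∀ t ∈ Icc a b, c * f t ^ α ≤ f' t) :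
    P b - P a ≤ (f a ^ (p + 1 - α) - f b ^ (p + 1 - α)) / (c * (α - p - 1)) := by
  have ha : a ∈ Icc a b := left_mem_Icc.2 hab.le
  have hb : b ∈ Icc a b := right_mem_Icc.2 hab.le
  have hd : 0 < c * (α - p - 1) := mul_pos hc (by linarith)
  -- `h = P + f^{p+1-α} / (c (α - p - 1))` and its derivative within `[a, b]`
  set r : ℝ := p + 1 - α with hr
  set h : ℝ → ℝ := fun s => P s + f s ^ r / (c * (α - p - 1)) with hh
  have hh' : ∀ s ∈ Icc a b, HasDerivWithinAt h
      (f s ^ p + f' s * r * f s ^ (r - 1) / (c * (α - p - 1))) (Icc a b) s := by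
    intro s hs
    have h1 : HasDerivWithinAt (fun y => f y ^ r) (f' s * r * f s ^ (r - 1)) (Icc a b) s :=
      (hf s hs).rpow_const (Or.inl (hpos s hs).ne')
    exact (hP s hs).add (h1.div_const (c * (α - p - 1)))
  -- `h` is nonincreasing on `[a, b]`
  have hanti : AntitoneOn h (Icc a b) := by
    refine antitoneOn_of_hasDerivWithinAt_nonpos (convex_Icc a b)
      (fun s hs => (hh' s hs).continuousWithinAt)
      (fun s hs => (hh' s (interior_subset hs)).mono interior_subset) fun s hs => ?_
    rw [interior_Icc] at hs
    have hs' : s ∈ Icc a b := Ioo_subset_Icc_self hs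
    have hfs : 0 < f s := hpos s hs'
    -- `f' f^{r-1} ≥ c f^α f^{p-α} = c f^p`
    have hr1 : r - 1 = p - α := by rw [hr]; ring
    have hpow : f s ^ α * f s ^ (p - α) = f s ^ p := by
      rw [← Real.rpow_add hfs]; congr 1; ring
    have hge' : c * f s ^ p ≤ f' s * f s ^ (r - 1) := by
      rw [hr1, ← hpow, ← mul_assoc]
      exact mul_le_mul_of_nonneg_right (hge s hs') (Real.rpow_nonneg hfs.le _)
    have hne : α - p - 1 ≠ 0 := by
      have : 0 < α - p - 1 := by linarith
      exact this.ne'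
    have e : f' s * r * f s ^ (r - 1) / (c * (α - p - 1)) = -(f' s * f s ^ (r - 1)) / c := by
      rw [div_eq_div_iff (mul_ne_zero hc.ne' hne) hc.ne', hr]
      ring
    rw [e, neg_div]
    have : f s ^ p ≤ f' s * f s ^ (r - 1) / c := by
      rw [le_div_iff₀ hc]; linarith [hge']
    linarith
  -- compare the endpoints
  have hcmp : h b ≤ h a := hanti ha hb hab.le
  simp only [hh] at hcmp
  rw [sub_div]
  linarith

/-- **Uniform-in-`b` form.** Under the same hypotheses, `P(b) − P(a) ≤ f(a)^{p+1−α}/(c(α−p−1))`: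
the primitive of `f^p` stays bounded independently of `b`, so growth at a rate exponent
`α > 1 + p` sustained up to a putative blow-up time keeps the LPS integral `∫ f^p` finite ("the
norm must not grow too rapidly"). [cite: Protas2026, §4.1, between eqs. (49) and (50)] -/
theorem primitive_sub_le_of_mul_rpow_le_deriv' {f f' P : ℝ → ℝ} {a b c α p : ℝ} (hab : a < b)
    (hc : 0 < c) (hαp : p + 1 < α)
    (hf : ∀ t ∈ Icc a b, HasDerivWithinAt f (f' t) (Icc a b) t)
    (hP : ∀ t ∈ Icc a b, HasDerivWithinAt P (f t ^ p) (Icc a b) t)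
    (hpos : ∀ t ∈ Icc a b, 0 < f t) (hge : ∀ t ∈ Icc a b, c * f t ^ α ≤ f' t) :
    P b - P a ≤ f a ^ (p + 1 - α) / (c * (α - p - 1)) := by
  have h := primitive_sub_le_of_mul_rpow_le_deriv hab hc hαp hf hP hpos hge
  have hd : 0 < c * (α - p - 1) := mul_pos hc (by linarith)
  have hfb : 0 < f b ^ (p + 1 - α) := Real.rpow_pos_of_pos (hpos b (right_mem_Icc.2 hab.le)) _
  have : (f a ^ (p + 1 - α) - f b ^ (p + 1 - α)) / (c * (α - p - 1)) ≤
      f a ^ (p + 1 - α) / (c * (α - p - 1)) :=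
    div_le_div_of_nonneg_right (by linarith) hd.le
  exact h.trans this

/-- The window edge in the Leray normalisation: with `p = 2q/(q − 3)` (`2/p + 3/q = 1`) the
critical rate exponent `1 + p` equals `3(q − 1)/(q − 3)`, the exponent of the instantaneous
estimate `d/dt ‖u‖_{L^q} ≤ C ‖u‖_{L^q}^{3(q−1)/(q−3)}` (essay (48) rewritten for the norm);
e.g. `q = 4, 5, 6, 9 ↦ 9, 6, 5, 4`. [cite: Protas2026, eq. (48)] -/
theorem one_add_lpsExponent_eq {q : ℝ} (hq : q ≠ 3) :
    1 + 2 * q / (q - 3) = 3 * (q - 1) / (q - 3) := by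
  have : q - 3 ≠ 0 := sub_ne_zero.2 hq
  field_simp
  ring

end BlowupWindow

end Literature.Analysis.FluidPDE

end
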